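import Summits.NavierStokesRegularity.FluidComputer.DesignedBlowupClayBridge
import Summits.NavierStokesRegularity.FluidComputer.ClayForceSliceBounds
import Literature.Analysis.FluidPDE.TaoForcedFiniteEnergyLerayHopfL2
import HarnessLib

/-!
# The energy class of a designed forced blow-up — FACT-FREE necessary conditions (row R10 / K1)

Cell `ns-blowup`, seat `ns-blowup-ecbridge-2` (g4; the E–C endpoint theory seat). LABEL: E–C typing
(KERNEL, no named fact). WHAT THIS IS NOT: not Navier–Stokes evidence — `DesignedBlowup ν`
(`DesignedBlowupClayBridge.lean`) is a TYPE and no inhabitant is asserted anywhere; the theorems say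
what ANY inhabitant must look like. Companion memo:
`run/shared/lean/pub/ns-blowup/ecbridge2/ECBRIDGE-2-MEMO-3.md`.

## Content

The seat's typed compatibility list (memo ECBRIDGE-2-MEMO-1 §2) records under row R10 / K1 what the
energy of ANY E–C claim must do at the blow-up time: bounded energy AND integrable dissipation up to
`T*`, the singularity being carried by higher norms only. For the generic E–C object of record,
`D : DesignedBlowup ν` (exact classical forced solution on `[0, T)`, Clay datum, Clay force smooth
THROUGH `T`, finite energy and a velocity bound on every CLOSED sub-slab `[0, T']`, `T' < T`, no
classical extension past `T`), the structure itself only carries slab-wise energy bounds `C(T')`,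
which a priori may blow up as `T' ↑ T`. This file proves, WITHOUT any named fact, that they do not:

* `DesignedBlowup.energy_dissipation_le` — ONE finite `E` with `∫|u(t)|² ≤ E` for all `t ∈ [0, T)`
  AND `ν ∫₀ᵀ∫|∇u|² ≤ E`: Tao 2013, Lemma 8.1 WITH force — the tree THEOREM
  `tao2011_forced_finiteEnergy_energyBound_holds` (lit g9) — on every `[0, T']`, the force side
  being uniform in `T'` because a Clay force has `L²` slices bounded uniformly in `t ≥ 0`
  (`ClayForceSliceBounds.clayForce_slice_bounds`), so `‖f‖_{L¹(0,T';L²)} ≤ T √C₀`; the dissipation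
  integral up to `T` by monotone convergence along `T' ↑ T`;
* `DesignedBlowup.energy_le`, `DesignedBlowup.lintegral_dissipation_lt_top` — the two halves;
* `DesignedBlowup.isLerayHopfOn` — on every closed sub-slab `[0, T']` the design IS a Leray–Hopf weak
  solution with force and `u ∈ C([0,T'];L²)` (lean g5's fact-free packaging
  `isLerayHopfOn_of_finiteEnergy_forced_L2`);
* `DesignedBlowup.energyEq` — the forced energy EQUALITY `½‖u(t)‖² + ν∫ₛᵗ∫|∇u|² = ½‖u(s)‖² + ∫ₛᵗ∫⟪f,u⟫`
  for all `0 ≤ s ≤ t < T`;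
* `DesignedBlowup.kineticEnergy_sub_le` — the work of the force is Lipschitz in time:
  `½‖u(t)‖² ≤ ½‖u(s)‖² + M (t − s)` with ONE constant `M` on the whole of `[0, T)`;
* `DesignedBlowup.tendsto_kineticEnergy` — **the kinetic energy HAS A LIMIT at the blow-up time**
  (`t ↦ ½‖u(t)‖² − M t` is antitone and bounded below on `[0, T)`): no energy jump, no energy
  oscillation at `T*`.

READING (memo MEMO-1 R10 «MUST»): a designed blow-up is never an energy blow-up nor a
dissipation-INTEGRAL blow-up, and its energy is continuous through `T*`; a design whose enstrophy
integral `∫₀ᵀ∫|∇u|²` diverges, or whose energy oscillates at `T`, is not an E–C claim (K1 kill), by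
theorems about the type — no fact hypothesis.

References: T. Tao, *Localisation and compactness properties of the Navier–Stokes global regularity
problem*, Anal. PDE 6 (2013) = arXiv:1108.1165, Lemma 8.1 (arXiv Lemma 44) with (6)–(9)
[cite: Tao2011, Lemma 8.1]; J. Leray, Acta Math. 63 (1934), §17 (3.4) (energy equality)
[cite: Leray1934, §17]; C. L. Fefferman, Clay problem description, (C) with (4)–(7)
[cite: FeffermanClay2006, (C)].
-/

noncomputable section

namespace Summit.NavierStokesRegularity.FluidComputer

namespace DesignedBlowup

open Set MeasureTheory Filter Topology Function
open scoped ENNReal NNReal RealInnerProductSpace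
open Literature.Analysis.FluidPDE

variable {ν : ℝ} (D : DesignedBlowup ν)

/-! ## §1 Slab bookkeeping -/

/-- A designed blow-up is classical on every CLOSED sub-slab `[0, T']`, `0 < T' < T`. [folklore] -/
theorem classical_Icc {T' : ℝ} (hT'0 : 0 < T') (hT' : T' < D.T) :
    IsClassicalNSSolutionOn (Icc 0 T') ν D.f D.u D.p :=
  D.classical.mono (Icc_subset_Ico_right hT') (uniqueDiffOn_Icc hT'0)

/-- The force of a designed blow-up has `L²` slices bounded uniformly in `t ≥ 0` (Clay decay (5);
`ClayForceSliceBounds.clayForce_slice_bounds`). [cite: FeffermanClay2006, (5)] -/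
theorem force_slice_sq_le : ∃ C₀ : ℝ≥0, ∀ t, 0 ≤ t → ∫⁻ x, ‖D.f t x‖ₑ ^ 2 ≤ C₀ :=
  (ClayForceSliceBounds.clayForce_slice_bounds D.force_smooth D.force_decay).1

/-- The midpoint `(t + T)/2` of `t ∈ [0, T)` and `T` is a legitimate slab end: positive, at least
`t`, before `T`. [folklore] -/
theorem midpoint_slab {t : ℝ} (ht : t ∈ Ico 0 D.T) :
    0 < (t + D.T) / 2 ∧ t ≤ (t + D.T) / 2 ∧ (t + D.T) / 2 < D.T := by
  obtain ⟨ht0, htT⟩ := ht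
  have hT := D.T_pos
  refine ⟨by linarith, by linarith, by linarith⟩

/-- The `L¹(0,T';L²)` norm of a force with `L²` slices bounded by `C₀` on `[0, T']` is at most
`√C₀ · T'`. [folklore] -/
theorem lintegral_sqrt_force_le {C₀ : ℝ≥0} (hC₀ : ∀ t, 0 ≤ t → ∫⁻ x, ‖D.f t x‖ₑ ^ 2 ≤ C₀)
    (T' : ℝ) :
    ∫⁻ t in Icc 0 T', (∫⁻ x, ‖D.f t x‖ₑ ^ 2) ^ (1 / 2 : ℝ) ≤
      (C₀ : ℝ≥0∞) ^ (1 / 2 : ℝ) * ENNReal.ofReal T' := by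
  calc ∫⁻ t in Icc 0 T', (∫⁻ x, ‖D.f t x‖ₑ ^ 2) ^ (1 / 2 : ℝ)
      ≤ ∫⁻ _ in Icc 0 T', (C₀ : ℝ≥0∞) ^ (1 / 2 : ℝ) :=
        setLIntegral_mono' measurableSet_Icc fun t ht => by gcongr; exact hC₀ t ht.1
    _ = (C₀ : ℝ≥0∞) ^ (1 / 2 : ℝ) * ENNReal.ofReal T' := by
        rw [setLIntegral_const, Real.volume_Icc, sub_zero]

/-! ## §2 Lemma 8.1 WITH force on every sub-slab: ONE bound for energy and dissipation -/

/-- **Uniform energy and dissipation bound for a designed blow-up (Tao 2013, Lemma 8.1 WITH force,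
applied on every `[0, T']` with a `T'`-independent right-hand side).** For `ν > 0` there is a finite
`E` with `∫|u(t)|² ≤ E` for EVERY `t ∈ [0, T)` and `ν ∫₀^{T'}∫|∇u|² ≤ E` for every `T' < T`.
(`E = C ((∫|u₀|²)^{1/2} + √C₀ T)²`, `C` Tao's absolute constant, `C₀` the Clay slice bound.)
No named fact. [cite: Tao2011, Lemma 8.1] -/
theorem energy_dissipation_le_slab (hν : 0 < ν) :
    ∃ E : ℝ≥0∞, E < ⊤ ∧ (∀ t ∈ Ico 0 D.T, ∫⁻ x, ‖D.u t x‖ₑ ^ 2 ≤ E) ∧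
      ∀ T' ∈ Ioo 0 D.T, ENNReal.ofReal ν *
        ∫⁻ t in Ioo 0 T', ∫⁻ x, ENNReal.ofReal (frobeniusNormSq (fderiv ℝ (D.u t) x)) ≤ E := by
  obtain ⟨C, hC, H⟩ := tao2011_forced_finiteEnergy_energyBound_holds
  obtain ⟨C₀, hC₀⟩ := D.force_slice_sq_le
  -- the datum has finite energy (slab `[0, T/2]`)
  obtain ⟨A₀, hA₀, hA₀b⟩ := D.energy (D.T / 2) (by linarith [D.T_pos])
  have hu0 : ∫⁻ x, ‖D.u 0 x‖ₑ ^ 2 < ⊤ :=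
    (hA₀b 0 ⟨le_rfl, by linarith [D.T_pos]⟩).trans_lt hA₀
  set E : ℝ≥0∞ := C * ((∫⁻ x, ‖D.u 0 x‖ₑ ^ 2) ^ (1 / 2 : ℝ) +
    (C₀ : ℝ≥0∞) ^ (1 / 2 : ℝ) * ENNReal.ofReal D.T) ^ 2 with hE
  have hEt : E < ⊤ := by
    refine ENNReal.mul_lt_top hC (ENNReal.pow_lt_top (ENNReal.add_lt_top.2 ⟨?_, ?_⟩))
    · exact ENNReal.rpow_lt_top_of_nonneg (by norm_num) hu0.ne
    · exact ENNReal.mul_lt_top (ENNReal.rpow_lt_top_of_nonneg (by norm_num) ENNReal.coe_ne_top)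
        ENNReal.ofReal_lt_top
  -- Lemma 8.1 on a closed sub-slab `[0, T']`, with the `T'`-independent right-hand side
  have key : ∀ T' ∈ Ioo 0 D.T,
      (∀ t ∈ Icc 0 T', ∫⁻ x, ‖D.u t x‖ₑ ^ 2 ≤ E) ∧
        ENNReal.ofReal ν *
          ∫⁻ t in Ioo 0 T', ∫⁻ x, ENNReal.ofReal (frobeniusNormSq (fderiv ℝ (D.u t) x)) ≤ E := by
    intro T' hT'
    have hsol := D.classical_Icc hT'.1 hT'.2
    have hfs : IsSmoothSpaceTimeOn (Icc 0 T') D.f :=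
      hsol.isSmoothSpaceTimeOn_force (uniqueDiffOn_Icc hT'.1)
    have hfL : ∫⁻ t in Icc 0 T', (∫⁻ x, ‖D.f t x‖ₑ ^ 2) ^ (1 / 2 : ℝ) ≤
        (C₀ : ℝ≥0∞) ^ (1 / 2 : ℝ) * ENNReal.ofReal D.T :=
      (D.lintegral_sqrt_force_le hC₀ T').trans (by gcongr; exact hT'.2.le)
    have hfE : ∫⁻ t in Icc 0 T', (∫⁻ x, ‖D.f t x‖ₑ ^ 2) ^ (1 / 2 : ℝ) < ⊤ :=
      hfL.trans_lt (ENNReal.mul_lt_top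
        (ENNReal.rpow_lt_top_of_nonneg (by norm_num) ENNReal.coe_ne_top) ENNReal.ofReal_lt_top)
    obtain ⟨A, hAt, hA⟩ := D.energy T' hT'.2
    have hE' : ∃ A : ℝ≥0, ∀ t ∈ Icc 0 T', ∫⁻ x, ‖D.u t x‖ₑ ^ 2 ≤ A :=
      ⟨A.toNNReal, fun t ht => (hA t ht).trans (ENNReal.coe_toNNReal hAt.ne).ge⟩
    obtain ⟨h1, h2⟩ := H hν hT'.1 hsol hfs hfE hE'
    have hrhs : C * ((∫⁻ x, ‖D.u 0 x‖ₑ ^ 2) ^ (1 / 2 : ℝ) +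
        ∫⁻ t in Icc 0 T', (∫⁻ x, ‖D.f t x‖ₑ ^ 2) ^ (1 / 2 : ℝ)) ^ 2 ≤ E := by
      rw [hE]
      gcongr
    exact ⟨fun t ht => (h1 t ht).trans hrhs, h2.trans hrhs⟩
  refine ⟨E, hEt, fun t ht => ?_, fun T' hT' => (key T' hT').2⟩
  obtain ⟨h0, htm, hmT⟩ := D.midpoint_slab ht
  exact (key _ ⟨h0, hmT⟩).1 t ⟨ht.1, htm⟩

/-- **ONE finite bound for the energy on `[0, T)` and the dissipation up to `T`.** For `ν > 0` there
is `E < ∞` with `∫|u(t)|² ≤ E` for every `t ∈ [0, T)` AND `ν ∫₀ᵀ∫|∇u|² ≤ E` (the dissipation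
integral over the WHOLE lifespan: monotone convergence along `T' ↑ T`,
`setLIntegral_iUnion_of_directed`). No named fact. [cite: Tao2011, Lemma 8.1] -/
theorem energy_dissipation_le (hν : 0 < ν) :
    ∃ E : ℝ≥0∞, E < ⊤ ∧ (∀ t ∈ Ico 0 D.T, ∫⁻ x, ‖D.u t x‖ₑ ^ 2 ≤ E) ∧
      ENNReal.ofReal ν *
        ∫⁻ t in Ioo 0 D.T, ∫⁻ x, ENNReal.ofReal (frobeniusNormSq (fderiv ℝ (D.u t) x)) ≤ E := by
  obtain ⟨E, hEt, hEn, hdis⟩ := D.energy_dissipation_le_slab hν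
  refine ⟨E, hEt, hEn, ?_⟩
  have hT := D.T_pos
  -- exhaust `(0, T)` by the slabs `(0, T - T/(n+2))`
  set Tn : ℕ → ℝ := fun n => D.T - D.T / (n + 2) with hTn
  have hTn_pos : ∀ n, 0 < Tn n := fun n => by
    have h2 : (2 : ℝ) ≤ (n : ℝ) + 2 := by
      have := (Nat.cast_nonneg n : (0 : ℝ) ≤ (n : ℝ)); linarith
    have : D.T / (n + 2) ≤ D.T / 2 := div_le_div_of_nonneg_left hT.le (by norm_num) h2
    simp only [hTn]; linarith
  have hTn_lt : ∀ n, Tn n < D.T := fun n => by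
    simp only [hTn]
    have : 0 < D.T / (n + 2) := div_pos hT (by positivity)
    linarith
  have hTn_mono : Monotone Tn := fun m n hmn => by
    simp only [hTn]
    have : D.T / (n + 2) ≤ D.T / (m + 2) :=
      div_le_div_of_nonneg_left hT.le (by positivity) (by exact_mod_cast Nat.add_le_add_right hmn 2)
    linarith
  have hmonoI : Monotone fun n => Ioo (0 : ℝ) (Tn n) := fun m n hmn =>
    Ioo_subset_Ioo_right (hTn_mono hmn)
  have hdir : Directed (· ⊆ ·) fun n => Ioo (0 : ℝ) (Tn n) := hmonoI.directed_le
  have hU : (⋃ n, Ioo (0 : ℝ) (Tn n)) = Ioo 0 D.T := by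
    refine Subset.antisymm (iUnion_subset fun n => Ioo_subset_Ioo_right (hTn_lt n).le) fun t ht => ?_
    obtain ⟨n, hn⟩ := exists_nat_gt (D.T / (D.T - t))
    have hTt : 0 < D.T - t := sub_pos.2 ht.2
    refine mem_iUnion.2 ⟨n, ht.1, ?_⟩
    simp only [hTn]
    have hn2 : D.T / (D.T - t) < (n : ℝ) + 2 := by linarith
    have : D.T / ((n : ℝ) + 2) < D.T - t := by
      rw [div_lt_iff₀ (by positivity)]
      have h1 : D.T = D.T / (D.T - t) * (D.T - t) := by field_simp
      have h2 : D.T / (D.T - t) * (D.T - t) < ((n : ℝ) + 2) * (D.T - t) :=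
        mul_lt_mul_of_pos_right hn2 hTt
      linarith [mul_comm ((n : ℝ) + 2) (D.T - t)]
    linarith
  rw [← hU, setLIntegral_iUnion_of_directed _ hdir, ENNReal.mul_iSup]
  exact iSup_le fun n => hdis (Tn n) ⟨hTn_pos n, hTn_lt n⟩

/-- **Uniform energy bound on `[0, T)`**: the energy of a designed blow-up does not blow up at
`T`. No named fact. [cite: Tao2011, Lemma 8.1] -/
theorem energy_le (hν : 0 < ν) :
    ∃ E : ℝ≥0∞, E < ⊤ ∧ ∀ t ∈ Ico 0 D.T, ∫⁻ x, ‖D.u t x‖ₑ ^ 2 ≤ E := by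
  obtain ⟨E, hEt, hEn, -⟩ := D.energy_dissipation_le_slab hν
  exact ⟨E, hEt, hEn⟩

/-- **Integrable dissipation THROUGH the blow-up time**: `∫₀ᵀ∫|∇u|² < ∞` for a designed blow-up
(`ν > 0`). The singularity is never a dissipation-integral blow-up. No named fact.
[cite: Tao2011, Lemma 8.1] -/
theorem lintegral_dissipation_lt_top (hν : 0 < ν) :
    ∫⁻ t in Ioo 0 D.T, ∫⁻ x, ENNReal.ofReal (frobeniusNormSq (fderiv ℝ (D.u t) x)) < ⊤ := by
  obtain ⟨E, hEt, -, hdis⟩ := D.energy_dissipation_le hν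
  have hν' : ENNReal.ofReal ν ≠ 0 := (ENNReal.ofReal_pos.2 hν).ne'
  rcases ENNReal.mul_lt_top_iff.1 (hdis.trans_lt hEt) with h | h | h
  · exact h.2
  · exact absurd h hν'
  · rw [h]; exact ENNReal.zero_lt_top

/-! ## §3 Leray–Hopf on every closed sub-slab and the forced energy equality -/

/-- **A designed blow-up is a Leray–Hopf weak solution WITH force on every closed sub-slab**
`[0, T']`, `0 < T' < T`, from its own datum, and `u ∈ C([0,T'];L²)` (lean g5's fact-free packaging
`isLerayHopfOn_of_finiteEnergy_forced_L2`: Lemma 8.1 with force + Lemma 4.1 (i) a.e. + the localised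
energy identity). No named fact. [cite: Tao2011, Lemma 8.1 + Lemma 4.1 (i)] -/
theorem isLerayHopfOn (hν : 0 < ν) {T' : ℝ} (hT'0 : 0 < T') (hT' : T' < D.T) :
    IsLerayHopfOn T' ν D.f (D.u 0) D.u ∧ ContinuousInLpOn (Icc 0 T') 2 D.u := by
  obtain ⟨C₀, hC₀⟩ := D.force_slice_sq_le
  exact (D.classical_Icc hT'0 hT').isLerayHopfOn_of_finiteEnergy_forced_L2 hν hT'0
    (Cf := C₀) ENNReal.coe_ne_top (fun t ht => hC₀ t ht.1) (D.energy T' hT')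

/-- **The forced energy EQUALITY along a designed blow-up**: for `0 ≤ s ≤ t < T`,
`½‖u(t)‖₂² + ν∫ₛᵗ∫|∇u|² = ½‖u(s)‖₂² + ∫ₛᵗ∫⟪f,u⟫` (Leray's (3.4) with the work of the force; Tao's
Lemma 8.1 in sharp form, fact-free in the tree). [cite: Leray1934, §17] [cite: Tao2011, Lemma 8.1] -/
theorem energyEq (hν : 0 < ν) {s t : ℝ} (hs : 0 ≤ s) (hst : s ≤ t) (ht : t < D.T) :
    VectorCalculus.kineticEnergy (D.u t) +
      ν * (∫⁻ τ in Ioo s t, ∫⁻ x, ENNReal.ofReal (frobeniusNormSq (fderiv ℝ (D.u τ) x))).toReal =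
      VectorCalculus.kineticEnergy (D.u s) + ∫ τ in Ioo s t, ∫ x, ⟪D.f τ x, D.u τ x⟫ := by
  obtain ⟨C₀, hC₀⟩ := D.force_slice_sq_le
  obtain ⟨h0, htm, hmT⟩ := D.midpoint_slab ⟨hs.trans hst, ht⟩
  obtain ⟨A, hAt, hA⟩ := D.energy _ hmT
  exact ((D.classical_Icc h0 hmT).energyEq_of_finiteEnergy_forced_L2_of_energy hν h0
    (Cf := C₀) ENNReal.coe_ne_top (fun τ hτ => hC₀ τ hτ.1) hAt.ne hA).2 hs hst htm

/-! ## §4 The energy is continuous THROUGH the blow-up time -/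

/-- **The work of a Clay force is Lipschitz in time, uniformly on `[0, T)`.** For `ν > 0` there is
ONE `M ≥ 0` with `½‖u(t)‖₂² ≤ ½‖u(s)‖₂² + M (t − s)` for all `0 ≤ s ≤ t < T` (energy equality,
dissipation `≥ 0`, and `|∫ₛᵗ∫⟪f,u⟫| ≤ √C₀ √E (t − s)` with the UNIFORM energy bound `E` of
`energy_le`). No named fact. [cite: Tao2011, Lemma 8.1] -/
theorem kineticEnergy_sub_le (hν : 0 < ν) :
    ∃ M : ℝ, 0 ≤ M ∧ ∀ s t : ℝ, 0 ≤ s → s ≤ t → t < D.T →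
      VectorCalculus.kineticEnergy (D.u t) ≤ VectorCalculus.kineticEnergy (D.u s) + M * (t - s) := by
  obtain ⟨C₀, hC₀⟩ := D.force_slice_sq_le
  obtain ⟨E, hEt, hE⟩ := D.energy_le hν
  refine ⟨((C₀ : ℝ≥0∞) ^ (1 / 2 : ℝ) * E ^ (1 / 2 : ℝ)).toReal, ENNReal.toReal_nonneg,
    fun s t hs hst ht => ?_⟩
  obtain ⟨h0, htm, hmT⟩ := D.midpoint_slab ⟨hs.trans hst, ht⟩
  have hsol := D.classical_Icc h0 hmT
  have hA : ∀ τ ∈ Icc 0 ((t + D.T) / 2), ∫⁻ x, ‖D.u τ x‖ₑ ^ 2 ≤ E := fun τ hτ =>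
    hE τ ⟨hτ.1, lt_of_le_of_lt hτ.2 hmT⟩
  have hW := hsol.abs_integral_inner_force_le h0 (Cf := C₀) ENNReal.coe_ne_top
    (fun τ hτ => hC₀ τ hτ.1) hEt.ne hA hs hst htm
  have heq := D.energyEq hν hs hst ht
  have hdis : 0 ≤ ν * (∫⁻ τ in Ioo s t,
      ∫⁻ x, ENNReal.ofReal (frobeniusNormSq (fderiv ℝ (D.u τ) x))).toReal :=
    mul_nonneg hν.le ENNReal.toReal_nonneg
  have hle := (abs_le.1 hW).2
  linarith

/-- **The kinetic energy of a designed blow-up HAS A LIMIT at the blow-up time** (`ν > 0`): there is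
`e` with `½‖u(t)‖₂² → e` as `t ↑ T`. Proof: with `M` from `kineticEnergy_sub_le`, the function
`t ↦ ½‖u(t)‖₂² − M t` is antitone and bounded below on `(0, T)`, hence converges at `T⁻`
(`AntitoneOn.tendsto_nhdsWithin_Ioo_left`). READING (memo MEMO-1, R10): the singularity of an E–C
claim is invisible in the energy — no jump, no oscillation at `T*`. No named fact.
[cite: Leray1934, §17] -/
theorem tendsto_kineticEnergy (hν : 0 < ν) :
    ∃ e : ℝ, Tendsto (fun t => VectorCalculus.kineticEnergy (D.u t)) (𝓝[<] D.T) (𝓝 e) := by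
  obtain ⟨M, hM0, hM⟩ := D.kineticEnergy_sub_le hν
  set φ : ℝ → ℝ := fun t => VectorCalculus.kineticEnergy (D.u t) - M * t with hφ
  have hanti : AntitoneOn φ (Ioo 0 D.T) := by
    intro s hs t ht hst
    simp only [hφ]
    have := hM s t hs.1.le hst ht.2
    nlinarith
  have hbdd : BddBelow (φ '' Ioo 0 D.T) := by
    refine ⟨-(M * D.T), ?_⟩
    rintro _ ⟨t, ht, rfl⟩
    simp only [hφ]
    have h1 := kineticEnergy_nonneg (D.u t)
    nlinarith [ht.2.le, ht.1.le]
  have hne : (Ioo 0 D.T).Nonempty := nonempty_Ioo.2 D.T_pos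
  have hlim := hanti.tendsto_nhdsWithin_Ioo_left hne hbdd
  refine ⟨sInf (φ '' Ioo 0 D.T) + M * D.T, ?_⟩
  have hid : Tendsto (fun t : ℝ => M * t) (𝓝[<] D.T) (𝓝 (M * D.T)) :=
    ((continuous_const.mul continuous_id).tendsto D.T).mono_left nhdsWithin_le_nhds
  have := hlim.add hid
  refine this.congr fun t => ?_
  simp only [hφ]
  ring

end DesignedBlowup

end Summit.NavierStokesRegularity.FluidComputer

end
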